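import Mathlib
import Summits.CriticalPhenomena.CardyFormulaZ2.Theorems.CardySelfRefinementGradientComparabilityStubNonAxialShareBulk
import Summits.CriticalPhenomena.CardyFormulaZ2.Theorems.CardySelfRefinementGradientComparabilityStubSlopeBoundsModification
import HarnessLib

/-!
# Slope bounds, Stage B (bulk): transfer of pivotality from axial to non-axial edges under `M_k`

Crux `stmt-CriticalPhenomena-10269`
(`Summit.CriticalPhenomena.CardyFormulaZ2.Theses.CardySelfRefinement.GradientComparability`),
line `monotone-product-coordinates`, helper file of the stub `stub_slopeBounds`.  Vocabulary
(`ax M Aloc window edgeOf`) from `CardySelfRefinementDefs`; the deterministic surgery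
`local_modification` and the offset bookkeeping (`exists_target_of_near`, `exists_eq_edgeOf_of_adj`)
from `…StubNonAxialShareBulk(Local)`; the cost of a local modification under `M_k(ρ,c)`
(`M_real_exists_modification_le`) from `…StubSlopeBoundsModification`.

## Mathematics

This is the landed Bernoulli transfer `stub_nonAxialShare_bulk` (line `Sketch`, for
`P_{1/2} = M_k(0,½)`) re-run under the dependent law `M_k(ρ,c)` with constants UNIFORM on
`ρ ∈ [0, 1-δ]`, `c ∈ [c_lo, c_hi] ⊂ (0,1)`: for `k ∈ {2,3}`, a finite quad family `F` and `r > 0`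
there are `c₁ > 0`, `η₄ > 0` such that for every mesh `η ∈ (0, η₄)`, every such `(ρ, c)` and the
set `Wb` of window edges whose ends are `r`-far from all sides of all quads,
`c₁ Σ_{e ∈ Wb} M(e pivotal for Aloc) ≤ Σ_{e ∈ W'} M(e pivotal for Aloc)` for a finite set `W'` of
NON-AXIAL edges (`nonAxialShare_bulk_M`, registered sub-goal).  Per edge
(`M_real_isPivotal_le_sum_targets`): an axial `e = edgeOf (v,d) ∈ Wb` pivotal in `ω` yields, by
`local_modification`, a non-axial target `e'` within four steps of `v` pivotal in a configuration
modified on at most `162` edges near `v`, at cost `(2K)^{162}`, `K = 2^k/(1-ρ) + 1/c + 1/(1-c) ≤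
2^k/δ + 1/c_lo + 1/(1-c_hi)`; summing over `Wb` and exchanging the sums (each offset map is
injective) gives `c₁ = (2K_max)^{-162}/162`, `η₄ = r/20`.  The boundary layer (edges within `r` of
a side) is NOT treated here.
-/

noncomputable section

namespace Summit.CriticalPhenomena.CardyFormulaZ2.Theorems.CardySelfRefinement

open scoped Topology
open Filter Set MeasureTheory
open Literature.Probability.LatticeModels Literature.Probability.Percolation
open Literature.Probability.Percolation.QuadCrossing
open Summit.CriticalPhenomena.CardyFormulaZ2.Theses.CardySelfRefinement

-- adapted from …StubNonAxialShareBulk.real_isPivotal_le_sum_targets (P_{1/2} ↦ M_k(ρ,c))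
/-- **Per-edge transfer under `M_k(ρ,c)`.**  For an edge `edgeOf vd` whose ends are `r`-far from
all sides (`r ≥ 20η`), `0 ≤ ρ < 1`, `0 < c < 1`:
`M(edgeOf vd pivotal for Aloc) ≤ (2K)^{162} Σ M(edgeOf t pivotal)` over the NON-AXIAL targets
`t = (v + Δ, d + ρ')`, `Δ ∈ [-4, 4]²`, `K = 2^k/(1-ρ) + 1/c + 1/(1-c)`. -/
theorem M_real_isPivotal_le_sum_targets {k : ℕ} (hk : k = 2 ∨ k = 3) {m : ℕ}
    (F : Fin m → Quad (Set.univ : Set ℂ)) {r η : ℝ} (hη : 0 < η) (hηr : 20 * η ≤ r)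
    {ρ : ℝ} (hρ : ρ ∈ Set.Ico (0 : ℝ) 1) {c : ℝ} (hc : c ∈ Set.Ioo (0 : ℝ) 1)
    (I₀ : Finset ((ℤ × ℤ) × Fin 2)) (hI₀ : ∀ ι, ι ∈ I₀ ↔ |ι.1.1| ≤ 4 ∧ |ι.1.2| ≤ 4)
    (hI₀card : I₀.card ≤ 162) (vd : Site 2 × Fin 2)
    (hfar : ∀ x ∈ edgeOf vd, ∀ (i : Fin m) (j : Fin 4), ∀ q ∈ (F i).side j,
      r ≤ dist ((η : ℂ) * squareLatticeEmbedding.z x) q) :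
    (M k ρ c).real {ω | IsPivotal (Aloc m F η) (edgeOf vd) ω} ≤
      (2 * (2 ^ k / (1 - ρ) + 1 / c + 1 / (1 - c))) ^ 162 *
        ∑ ι ∈ I₀.filter (fun ι => ¬ ax k (vd.1 + ![ι.1.1, ι.1.2], vd.2 + ι.2)),
          (M k ρ c).real {ω | IsPivotal (Aloc m F η) (edgeOf (vd.1 + ![ι.1.1, ι.1.2], vd.2 + ι.2)) ω} := by
  classical
  obtain ⟨v, d⟩ := vd
  have hk0 : 0 < k := by rcases hk with rfl | rfl <;> norm_num
  haveI := isProbabilityMeasure_M k ρ c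
  set μ := M k ρ c with hμ
  obtain ⟨L, hL⟩ : ∃ L : ℝ, L = 2 * (2 ^ k / (1 - ρ) + 1 / c + 1 / (1 - c)) := ⟨_, rfl⟩
  rw [← hL]
  have hL1 : 1 ≤ L := by
    have hA : 0 ≤ (2 : ℝ) ^ k / (1 - ρ) := div_nonneg (by positivity) (by linarith [hρ.2])
    have hB : 1 ≤ 1 / c := by rw [le_div_iff₀ hc.1]; linarith [hc.2]
    have hC : 0 ≤ 1 / (1 - c) := div_nonneg zero_le_one (by linarith [hc.2])
    rw [hL]
    linarith
  have hmod : ∀ E : Set (BondConfig (Site 2)), MeasurableSet E → ∀ N : Finset (Sym2 (Site 2)),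
      (∀ e ∈ N, ∃ (v' : Site 2) (d' : Fin 2), e = edgeOf (v', d')) →
      μ.real {ω | ∃ Rm S : Set (Sym2 (Site 2)), Rm ∪ S ⊆ ↑N ∧ ω \ Rm ∪ S ∈ E} ≤ L ^ N.card * μ.real E := by
    intro E hE N hN
    have h := M_real_exists_modification_le k hk0 ρ hρ c hc N hN E hE
    rw [← hL] at h
    exact h
  obtain ⟨N, hN_def⟩ : ∃ N : Finset (Sym2 (Site 2)), N = I₀.image fun ι => edgeOf (v + ![ι.1.1, ι.1.2], ι.2) :=
    ⟨_, rfl⟩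
  have hN : ∀ e ∈ N, ∃ (v' : Site 2) (d' : Fin 2), e = edgeOf (v', d') := by
    intro x hx
    rw [hN_def] at hx
    obtain ⟨ι, -, hι⟩ := Finset.mem_image.1 hx
    exact ⟨_, _, hι.symm⟩
  have hNcard : N.card ≤ 162 := by rw [hN_def]; exact Finset.card_image_le.trans hI₀card
  have hmeas : ∀ e, MeasurableSet {ω : BondConfig (Site 2) | IsPivotal (Aloc m F η) e ω} := fun e =>
    measurableSet_setOf_isPivotal (measurableSet_Aloc m F hη.ne') e
  have hnonneg : ∀ ι ∈ I₀.filter (fun ι => ¬ ax k (v + ![ι.1.1, ι.1.2], d + ι.2)),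
      0 ≤ μ.real {ω | IsPivotal (Aloc m F η) (edgeOf (v + ![ι.1.1, ι.1.2], d + ι.2)) ω} :=
    fun _ _ => measureReal_nonneg
  have h8 : (1 : ℝ) ≤ L ^ 162 := one_le_pow₀ hL1
  by_cases hax : ax k (v, d)
  · -- axial: local modification
    have hcov : {ω : BondConfig (Site 2) | IsPivotal (Aloc m F η) (edgeOf (v, d)) ω} ⊆
        ⋃ ι ∈ I₀.filter (fun ι => ¬ ax k (v + ![ι.1.1, ι.1.2], d + ι.2)),
          {ω | ∃ Rm S : Set (Sym2 (Site 2)), Rm ∪ S ⊆ ↑N ∧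
            ω \ Rm ∪ S ∈ {ω | IsPivotal (Aloc m F η) (edgeOf (v + ![ι.1.1, ι.1.2], d + ι.2)) ω}} := by
      intro ω hω
      obtain ⟨Rm, S, e', ⟨v', d', he', hnax, hv'⟩, hnear, hpiv'⟩ :=
        local_modification hk F hη hηr hax hfar hω
      have hvv' : v + ![v' 0 - v 0, v' 1 - v 1] = v' := by ext i; fin_cases i <;> simp
      have hdd' : d + (d' - d) = d' := by abel
      refine Set.mem_iUnion₂.2 ⟨((v' 0 - v 0, v' 1 - v 1), d' - d), Finset.mem_filter.2 ⟨?_, ?_⟩,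
        Rm, S, fun x hx => ?_, ?_⟩
      · exact (hI₀ _).2 ⟨hv' 0, hv' 1⟩
      · show ¬ ax k (v + ![v' 0 - v 0, v' 1 - v 1], d + (d' - d))
        rw [hvv', hdd']; exact hnax
      · obtain ⟨ι, hι, hιx⟩ := exists_target_of_near (hnear x hx)
        rw [Finset.mem_coe, hN_def, Finset.mem_image]
        exact ⟨ι, (hI₀ ι).2 hι, hιx⟩
      · show ω \ Rm ∪ S ∈ {ω | IsPivotal (Aloc m F η) (edgeOf (v + ![v' 0 - v 0, v' 1 - v 1], d + (d' - d))) ω}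
        rw [hvv', hdd', ← he']; exact hpiv'
    calc μ.real {ω | IsPivotal (Aloc m F η) (edgeOf (v, d)) ω}
        ≤ μ.real (⋃ ι ∈ I₀.filter (fun ι => ¬ ax k (v + ![ι.1.1, ι.1.2], d + ι.2)),
            {ω | ∃ Rm S : Set (Sym2 (Site 2)), Rm ∪ S ⊆ ↑N ∧
              ω \ Rm ∪ S ∈ {ω | IsPivotal (Aloc m F η) (edgeOf (v + ![ι.1.1, ι.1.2], d + ι.2)) ω}}) :=
          measureReal_mono hcov (measure_ne_top _ _)
      _ ≤ ∑ ι ∈ I₀.filter (fun ι => ¬ ax k (v + ![ι.1.1, ι.1.2], d + ι.2)),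
            μ.real {ω | ∃ Rm S : Set (Sym2 (Site 2)), Rm ∪ S ⊆ ↑N ∧
              ω \ Rm ∪ S ∈ {ω | IsPivotal (Aloc m F η) (edgeOf (v + ![ι.1.1, ι.1.2], d + ι.2)) ω}} :=
          measureReal_biUnion_finset_le (μ := μ) _ _
      _ ≤ ∑ ι ∈ I₀.filter (fun ι => ¬ ax k (v + ![ι.1.1, ι.1.2], d + ι.2)),
            L ^ 162 * μ.real {ω | IsPivotal (Aloc m F η) (edgeOf (v + ![ι.1.1, ι.1.2], d + ι.2)) ω} := by
          refine Finset.sum_le_sum fun ι _ => (hmod _ (hmeas _) N hN).trans ?_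
          exact mul_le_mul_of_nonneg_right (pow_le_pow_right₀ hL1 hNcard) measureReal_nonneg
      _ = _ := by rw [Finset.mul_sum]
  · -- non-axial: the edge itself is a target
    have hv0 : v + ![0, 0] = v := by ext i; fin_cases i <;> simp
    have hmem : (((0 : ℤ), (0 : ℤ)), (0 : Fin 2)) ∈ I₀.filter (fun ι => ¬ ax k (v + ![ι.1.1, ι.1.2], d + ι.2)) := by
      refine Finset.mem_filter.2 ⟨(hI₀ _).2 ⟨by norm_num, by norm_num⟩, ?_⟩
      show ¬ ax k (v + ![0, 0], d + 0)
      rw [hv0, add_zero]; exact hax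
    have hsingle := Finset.single_le_sum hnonneg hmem
    have heq : μ.real {ω | IsPivotal (Aloc m F η) (edgeOf (v + ![0, 0], d + 0)) ω} =
        μ.real {ω | IsPivotal (Aloc m F η) (edgeOf (v, d)) ω} := by rw [hv0, add_zero]
    calc μ.real {ω | IsPivotal (Aloc m F η) (edgeOf (v, d)) ω}
        ≤ 1 * ∑ ι ∈ I₀.filter (fun ι => ¬ ax k (v + ![ι.1.1, ι.1.2], d + ι.2)),
            μ.real {ω | IsPivotal (Aloc m F η) (edgeOf (v + ![ι.1.1, ι.1.2], d + ι.2)) ω} := by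
          rw [one_mul, ← heq]; exact hsingle
      _ ≤ _ := mul_le_mul_of_nonneg_right h8 (Finset.sum_nonneg hnonneg)

-- adapted from …StubNonAxialShareBulk.stub_nonAxialShare_bulk (P_{1/2} ↦ M_k(ρ,c), uniform constants)
/-- **Stage B (bulk) of `stub_slopeBounds`** (registered sub-goal `nonAxialShare_bulk_M`): bulk
transfer of pivotality to non-axial edges under `M_k(ρ,c)`, with constants uniform on
`ρ ∈ [0, 1-δ]`, `c ∈ [c_lo, c_hi] ⊂ (0,1)`.  For `k ∈ {2,3}`, a finite quad family `F`, `r > 0`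
and such a parameter box there are `c₁ > 0`, `η₄ > 0` with: for every mesh `η ∈ (0, η₄)`, every
`(ρ, c)` in the box and the set `Wb` of window edges `r`-far from all sides of all quads,
`c₁ Σ_{e ∈ Wb} M(e pivotal for Aloc) ≤ Σ_{e ∈ W'} M(e pivotal for Aloc)` for a finite set `W'` of
NON-AXIAL edges. -/
theorem nonAxialShare_bulk_M :
    ∀ k : ℕ, k = 2 ∨ k = 3 → ∀ (m : ℕ) (F : Fin m → Quad (Set.univ : Set ℂ)) (r : ℝ), 0 < r → ∀ δ cl ch : ℝ, 0 < δ → 0 < cl → ch < 1 → ∃ c₁ η₄ : ℝ, 0 < c₁ ∧ 0 < η₄ ∧ ∀ η ∈ Set.Ioo 0 η₄, ∀ ρ ∈ Set.Icc (0 : ℝ) (1 - δ), ∀ c ∈ Set.Icc cl ch, ∀ Wb : Finset (Sym2 (Site 2)), (↑Wb : Set (Sym2 (Site 2))) = {e ∈ window m F η | ∀ x ∈ e, ∀ (i : Fin m) (j : Fin 4), ∀ p ∈ (F i).side j, r ≤ dist ((η : ℂ) * squareLatticeEmbedding.z x) p} → ∃ W' : Finset (Sym2 (Site 2)), (∀ e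 ∈ W', ∃ (v : Site 2) (d : Fin 2), e = edgeOf (v, d) ∧ ¬ ax k (v, d)) ∧ c₁ * (∑ e ∈ Wb, (M k ρ c).real {ω | IsPivotal (Aloc m F η) e ω}) ≤ ∑ e ∈ W', (M k ρ c).real {ω | IsPivotal (Aloc m F η) e ω} := by
  intro k hk m F r hr δ cl ch hδ hcl hch
  classical
  -- the offsets `(Δ, ρ')`, `|Δ|_∞ ≤ 4`
  obtain ⟨I₀, hI₀, hI₀card⟩ : ∃ I₀ : Finset ((ℤ × ℤ) × Fin 2),
      (∀ ι, ι ∈ I₀ ↔ |ι.1.1| ≤ 4 ∧ |ι.1.2| ≤ 4) ∧ I₀.card = 162 := by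
    refine ⟨(Finset.Icc (-4 : ℤ) 4 ×ˢ Finset.Icc (-4 : ℤ) 4) ×ˢ (Finset.univ : Finset (Fin 2)),
      fun ι => ?_, by simp⟩
    simp only [Finset.mem_product, Finset.mem_Icc, Finset.mem_univ, and_true, abs_le]
  -- the uniform constant
  obtain ⟨Lm, hLm⟩ : ∃ Lm : ℝ, Lm = 2 * (2 ^ k / δ + 1 / cl + 1 / (1 - ch)) := ⟨_, rfl⟩
  have hLm0 : 0 < Lm := by
    have hA : 0 ≤ (2 : ℝ) ^ k / δ := div_nonneg (by positivity) hδ.le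
    have hB : 0 < 1 / cl := div_pos one_pos hcl
    have hC : 0 ≤ 1 / (1 - ch) := div_nonneg zero_le_one (by linarith)
    rw [hLm]
    linarith
  refine ⟨1 / (Lm ^ 162 * 162), r / 20, by positivity, by positivity, fun η hη ρ hρ c hc Wb hWb => ?_⟩
  have hη0 : 0 < η := hη.1
  have hηr : 20 * η ≤ r := by linarith [hη.2]
  have hρ' : ρ ∈ Set.Ico (0 : ℝ) 1 := ⟨hρ.1, by linarith [hρ.2]⟩
  have hc' : c ∈ Set.Ioo (0 : ℝ) 1 := ⟨lt_of_lt_of_le hcl hc.1, lt_of_le_of_lt hc.2 hch⟩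
  -- the constant at `(ρ, c)` is dominated by the uniform one
  obtain ⟨L, hL⟩ : ∃ L : ℝ, L = 2 * (2 ^ k / (1 - ρ) + 1 / c + 1 / (1 - c)) := ⟨_, rfl⟩
  have hLLm : L ≤ Lm := by
    have hA : (2 : ℝ) ^ k / (1 - ρ) ≤ 2 ^ k / δ :=
      div_le_div_of_nonneg_left (by positivity) hδ (by linarith [hρ.2])
    have hB : 1 / c ≤ 1 / cl := one_div_le_one_div_of_le hcl hc.1
    have hC : 1 / (1 - c) ≤ 1 / (1 - ch) := one_div_le_one_div_of_le (by linarith) (by linarith [hc.2])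
    rw [hL, hLm]
    linarith
  have hL0 : 0 ≤ L := by
    have hA : 0 ≤ (2 : ℝ) ^ k / (1 - ρ) := div_nonneg (by positivity) (by linarith [hρ.2])
    have hB : 0 ≤ 1 / c := div_nonneg zero_le_one hc'.1.le
    have hC : 0 ≤ 1 / (1 - c) := div_nonneg zero_le_one (by linarith [hc'.2])
    rw [hL]
    linarith
  have hpowL : L ^ 162 ≤ Lm ^ 162 := pow_le_pow_left₀ hL0 hLLm 162
  haveI := isProbabilityMeasure_M k ρ c
  set μ := M k ρ c with hμ
  set P : Sym2 (Site 2) → ℝ := fun e => μ.real {ω | IsPivotal (Aloc m F η) e ω} with hP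
  have hP0 : ∀ e, 0 ≤ P e := fun e => measureReal_nonneg
  set tgt : Site 2 × Fin 2 → (ℤ × ℤ) × Fin 2 → Site 2 × Fin 2 :=
    fun vd ι => (vd.1 + ![ι.1.1, ι.1.2], vd.2 + ι.2) with htgt
  -- the edges of `Wb`
  have hWb' : ∀ e ∈ Wb, e ∈ window m F η ∧ ∀ x ∈ e, ∀ (i : Fin m) (j : Fin 4),
      ∀ p ∈ (F i).side j, r ≤ dist ((η : ℂ) * squareLatticeEmbedding.z x) p := fun e he => by
    have : e ∈ (↑Wb : Set (Sym2 (Site 2))) := he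
    rw [hWb] at this
    exact this
  have hWsub : window m F η ⊆ (zdGraph 2).edgeSet := Set.iUnion_subset fun i => Set.inter_subset_right
  have hrange : ∀ e ∈ Wb, e ∈ Set.range (edgeOf : Site 2 × Fin 2 → Sym2 (Site 2)) := by
    intro e he
    have hE := hWsub (hWb' e he).1
    revert hE
    refine Sym2.ind (fun x y hE => ?_) e
    obtain ⟨d, h | h⟩ := exists_eq_edgeOf_of_adj ((SimpleGraph.mem_edgeSet _).1 hE)
    exacts [⟨_, h.symm⟩, ⟨_, h.symm⟩]
  have hinj : Set.InjOn (edgeOf : Site 2 × Fin 2 → Sym2 (Site 2)) (edgeOf ⁻¹' ↑Wb) :=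
    edgeOf_injective.injOn
  set Vb : Finset (Site 2 × Fin 2) := Wb.preimage edgeOf hinj with hVb
  have hsumWb : ∑ e ∈ Wb, P e = ∑ vd ∈ Vb, P (edgeOf vd) :=
    (Finset.sum_preimage edgeOf Wb hinj P (fun e he hne => (hne (hrange e he)).elim)).symm
  -- per-edge transfer
  have hper : ∀ vd ∈ Vb, P (edgeOf vd) ≤
      Lm ^ 162 * ∑ ι ∈ I₀.filter (fun ι => ¬ ax k (tgt vd ι)), P (edgeOf (tgt vd ι)) := by
    intro vd hvd
    have h := M_real_isPivotal_le_sum_targets hk F hη0 hηr hρ' hc' I₀ hI₀ hI₀card.le vd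
      (hWb' (edgeOf vd) (Finset.mem_preimage.1 hvd)).2
    rw [← hL] at h
    exact h.trans (mul_le_mul_of_nonneg_right hpowL (Finset.sum_nonneg fun ι _ => hP0 _))
  -- the non-axial targets
  set W' : Finset (Sym2 (Site 2)) := I₀.biUnion fun ι =>
    (Vb.filter (fun vd => ¬ ax k (tgt vd ι))).image (fun vd => edgeOf (tgt vd ι)) with hW'
  have hinjι : ∀ ι, Function.Injective (fun vd : Site 2 × Fin 2 => edgeOf (tgt vd ι)) := by
    intro ι a b h
    have h' := edgeOf_injective h
    simp only [htgt, Prod.mk.injEq, add_left_inj] at h'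
    exact Prod.ext h'.1 h'.2
  refine ⟨W', fun e he => ?_, ?_⟩
  · obtain ⟨ι, -, he⟩ := Finset.mem_biUnion.1 he
    obtain ⟨vd, hvd, rfl⟩ := Finset.mem_image.1 he
    exact ⟨_, _, rfl, (Finset.mem_filter.1 hvd).2⟩
  -- exchange the sums
  have hinner : ∀ ι ∈ I₀, ∑ vd ∈ Vb.filter (fun vd => ¬ ax k (tgt vd ι)), P (edgeOf (tgt vd ι)) ≤
      ∑ e ∈ W', P e := by
    intro ι hι
    rw [← Finset.sum_image (f := P) (g := fun vd => edgeOf (tgt vd ι)) fun a _ b _ h => hinjι ι h]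
    exact Finset.sum_le_sum_of_subset_of_nonneg
      (Finset.subset_biUnion_of_mem (fun ι => (Vb.filter (fun vd => ¬ ax k (tgt vd ι))).image
        (fun vd => edgeOf (tgt vd ι))) hι) (fun e _ _ => hP0 e)
  have hexch : ∑ vd ∈ Vb, ∑ ι ∈ I₀.filter (fun ι => ¬ ax k (tgt vd ι)), P (edgeOf (tgt vd ι)) =
      ∑ ι ∈ I₀, ∑ vd ∈ Vb.filter (fun vd => ¬ ax k (tgt vd ι)), P (edgeOf (tgt vd ι)) := by
    simp only [Finset.sum_filter]
    exact Finset.sum_comm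
  have hbound : ∑ e ∈ Wb, P e ≤ Lm ^ 162 * 162 * ∑ e ∈ W', P e :=
    calc ∑ e ∈ Wb, P e = ∑ vd ∈ Vb, P (edgeOf vd) := hsumWb
      _ ≤ ∑ vd ∈ Vb, Lm ^ 162 * ∑ ι ∈ I₀.filter (fun ι => ¬ ax k (tgt vd ι)), P (edgeOf (tgt vd ι)) :=
          Finset.sum_le_sum hper
      _ = Lm ^ 162 * ∑ ι ∈ I₀, ∑ vd ∈ Vb.filter (fun vd => ¬ ax k (tgt vd ι)), P (edgeOf (tgt vd ι)) := by
          rw [← Finset.mul_sum, hexch]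
      _ ≤ Lm ^ 162 * ∑ _ι ∈ I₀, ∑ e ∈ W', P e :=
          mul_le_mul_of_nonneg_left (Finset.sum_le_sum hinner) (by positivity)
      _ = Lm ^ 162 * 162 * ∑ e ∈ W', P e := by
          rw [Finset.sum_const, hI₀card, nsmul_eq_mul]; push_cast; ring
  have hW'0 : 0 ≤ ∑ e ∈ W', P e := Finset.sum_nonneg fun e _ => hP0 e
  calc 1 / (Lm ^ 162 * 162) * ∑ e ∈ Wb, P e
      ≤ 1 / (Lm ^ 162 * 162) * (Lm ^ 162 * 162 * ∑ e ∈ W', P e) :=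
        mul_le_mul_of_nonneg_left hbound (by positivity)
    _ = ∑ e ∈ W', P e := by field_simp

end Summit.CriticalPhenomena.CardyFormulaZ2.Theorems.CardySelfRefinement

end
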